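import Summits.Ventures.Crystal3D.Theorems.StickyWulffConstantGenericWallFloorPayerPoolSep
import Summits.Ventures.Crystal3D.Theorems.StickyWulffConstantGenericWallFloorPayerPoolOffReach
import HarnessLib

/-!
# Payer pools at every plate thickness `R₀ ≥ 10`: RE-ANCHORING the thickness-`10` ledgers (crux `GenericWallFloor`,
# stmt-Ventures-19480, line `WallLedgerG`; debt G-U for lane T — the `∀ R₀ ≥ R` shape of T's `…From` parts)

HONEST FRAMING. Venture `Summits/Ventures/Crystal3D` (cell `crystal3d-full`), helper `--supports` the crux `GenericWallFloor` of
`route-Ventures-StickyWulffConstant`, registered line `WallLedgerG`, open stub `stub_twoSlabAdhesion`.  Pure cell bookkeeping; rung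
credit only; F-C1 not moved.  Inputs BY NAME as in `…PayerPoolSep` / `…PayerPoolOffReach`.

WHY.  Lane T's wall parts quantify `∀ R₀ ≥ R, ∃ C, ∀ pairs` (wulff-p2's Q-T′: `BilayerWallAt` is not monotone in the plate thickness
because the windows move), while lane G's payer-pool ledgers are proved at thickness `10`.  Because those ledgers are UNIFORM IN THE
TRANSLATIONS, a cell of thickness `R₀ ≥ 10` reduces to one of thickness `10`: truncate `X` to the heights `[−R₀−10, h+R₀+10]`, shift by
`(R₀ − 10)·e₃`, and run the thickness-`10` ledger with `h″ = h + 2(R₀ − 10)`; the thin plates are complete because they sit inside the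
thick ones, every ball of the new cell lies in the old cylinder, and the payer windows correspond EXACTLY (`−R₀−2 ≤ y₂ ≤ h+R₀+2` ↔
`−12 ≤ y″₂ ≤ h″+12`) with equal degrees (all neighbours of a payer survive the truncation).
* **`payerPool_reanchor`** — the abstract step: a payer-pool inequality `Φπρ² − K(1+h)ρ ≤ Σ_{PAY₁₀}(12−deg)` valid for ALL translations
  at thickness `10` gives `Φπρ² − K(1 + h + 2(R₀−10))ρ ≤ Σ_{PAY_{R₀}}(12−deg)` at every thickness `R₀ ≥ 10`;
* **`payerPool_local_sep_thick`**, **`payerPool_offReach_thick`** — the two uniform two-family pools of lane G at every `R₀ ≥ 10`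
  (separated frame sets, resp. disjoint reach sets — the latter transported along the shift by `reachSet_shift`).
WHAT THIS IS NOT: no new ledger; the T-side identification of a `BothFcc` plate with the affine lattice of its bilayer frame and the call
to `bilayerWallAt_of_payerBound` are lane T's; F-C1 not moved.
-/

noncomputable section

namespace Summit.Ventures.Crystal3D.Theorems

open Summit.Ventures.Crystal3D Finset
open Literature.MathematicalPhysics.StatisticalMechanics (fccStacking barlowStacking IsHaggSeq)
open scoped InnerProductSpace

/-! ### Vertical shifts -/

/-- A coordinate difference is at most the distance. -/
private theorem abs_sub_apply_le_dist (p q : EuclideanSpace ℝ (Fin 3)) (i : Fin 3) : |p i - q i| ≤ dist p q := by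
  have h : dist (p i) (q i) ^ 2 ≤ ∑ j, dist (p j) (q j) ^ 2 :=
    Finset.single_le_sum (fun j _ => sq_nonneg (dist (p j) (q j))) (Finset.mem_univ i)
  calc |p i - q i| = dist (p i) (q i) := (Real.dist_eq _ _).symm
    _ = Real.sqrt (dist (p i) (q i) ^ 2) := (Real.sqrt_sq dist_nonneg).symm
    _ ≤ Real.sqrt (∑ j, dist (p j) (q j) ^ 2) := Real.sqrt_le_sqrt h
    _ = dist p q := (EuclideanSpace.dist_eq p q).symm

/-- Coordinates of a vertically shifted point. -/
theorem shift_apply (p : EuclideanSpace ℝ (Fin 3)) (τ : ℝ) :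
    (p + τ • EuclideanSpace.single (2 : Fin 3) (1 : ℝ)) 2 = p 2 + τ ∧
    (p + τ • EuclideanSpace.single (2 : Fin 3) (1 : ℝ)) 0 = p 0 ∧
    (p + τ • EuclideanSpace.single (2 : Fin 3) (1 : ℝ)) 1 = p 1 := by
  refine ⟨?_, ?_, ?_⟩ <;> simp

/-- A shifted affine lattice. -/
theorem mem_affine_shift_iff (A : EuclideanSpace ℝ (Fin 3) ≃ₗᵢ[ℝ] EuclideanSpace ℝ (Fin 3)) (t v p : EuclideanSpace ℝ (Fin 3)) :
    p + v ∈ (fun q => A q + (t + v)) '' fccStacking 1 (Real.sqrt (2 / 3)) ↔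
      p ∈ (fun q => A q + t) '' fccStacking 1 (Real.sqrt (2 / 3)) := by
  constructor
  · rintro ⟨q, hq, e⟩
    refine ⟨q, hq, ?_⟩
    simp only at e ⊢
    rw [show A q + t = (A q + (t + v)) - v by abel, e, add_sub_cancel_right]
  · rintro ⟨q, hq, e⟩
    refine ⟨q, hq, ?_⟩
    simp only at e ⊢
    rw [← e]; abel

/-- **The reach set shifts with the translation**: `y ∈ reachSet A t M ↔ y + v ∈ reachSet A (t + v) M`. -/
theorem reachSet_shift (A : EuclideanSpace ℝ (Fin 3) ≃ₗᵢ[ℝ] EuclideanSpace ℝ (Fin 3)) (t v : EuclideanSpace ℝ (Fin 3))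
    (M : Set (EuclideanSpace ℝ (Fin 3) ≃ₗᵢ[ℝ] EuclideanSpace ℝ (Fin 3))) (y : EuclideanSpace ℝ (Fin 3)) :
    y ∈ reachSet A t M ↔ y + v ∈ reachSet A (t + v) M := by
  constructor
  · rintro ⟨x, hx, w, hw, rfl⟩
    exact ⟨x, hx, w, hw, by abel⟩
  · rintro ⟨x, hx, w, hw, e⟩
    exact ⟨x, hx, w, hw, by have := congrArg (· - v) e; simp only [add_sub_cancel_right] at this; rw [this]; abel⟩

/-! ### The re-anchoring -/

open scoped Classical in
/-- **RE-ANCHORING.**  A payer-pool inequality at thickness `10`, valid for all translations of the two lattices, holds at every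
thickness `R₀ ≥ 10` with `h` replaced by `h + 2(R₀ − 10)` in the rim constant.  See the module docstring. -/
theorem payerPool_reanchor
    (A₁ A₂ : EuclideanSpace ℝ (Fin 3) ≃ₗᵢ[ℝ] EuclideanSpace ℝ (Fin 3)) (t₁ t₂ : EuclideanSpace ℝ (Fin 3)) {Φ K : ℝ}
    (hpool10 : ∀ (w : EuclideanSpace ℝ (Fin 3)) (h : ℝ), 0 ≤ h → ∀ ρ : ℝ, 10 ≤ ρ →
      ∀ X P₁ P₂ : Finset (EuclideanSpace ℝ (Fin 3)),
      (∀ p ∈ X, ∀ q ∈ X, p ≠ q → 1 ≤ dist p q) → P₁ ⊆ X → P₂ ⊆ X \ P₁ →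
      (∀ p ∈ X, -(2 * 10) ≤ p 2 ∧ p 2 ≤ h + 2 * 10 ∧ p 0 ^ 2 + p 1 ^ 2 ≤ ρ ^ 2) →
      (∀ p, p ∈ P₁ ↔ (p ∈ (fun q => A₁ q + (t₁ + w)) '' fccStacking 1 (Real.sqrt (2 / 3)) ∧
        -(2 * 10) ≤ p 2 ∧ p 2 ≤ -10 ∧ p 0 ^ 2 + p 1 ^ 2 ≤ ρ ^ 2)) →
      (∀ p, p ∈ P₂ ↔ (p ∈ (fun q => A₂ q + (t₂ + w)) '' fccStacking 1 (Real.sqrt (2 / 3)) ∧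
        h + 10 ≤ p 2 ∧ p 2 ≤ h + 2 * 10 ∧ p 0 ^ 2 + p 1 ^ 2 ≤ ρ ^ 2)) →
      Φ * Real.pi * ρ ^ 2 - K * (1 + h) * ρ ≤
        ∑ y ∈ X.filter (fun y => (X.filter fun q => dist y q = 1).card ≠ 12 ∧ -10 - 2 ≤ y 2 ∧ y 2 ≤ h + 10 + 2),
          ((12 : ℝ) - ((X.filter fun q => dist y q = 1).card : ℝ)))
    {R₀ : ℝ} (hR₀ : 10 ≤ R₀) (h : ℝ) (hh : 0 ≤ h) (ρ : ℝ) (hρ : R₀ ≤ ρ)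
    (X P₁ P₂ : Finset (EuclideanSpace ℝ (Fin 3)))
    (hX : ∀ p ∈ X, ∀ q ∈ X, p ≠ q → 1 ≤ dist p q) (hP₁X : P₁ ⊆ X) (hP₂X : P₂ ⊆ X \ P₁)
    (hcell : ∀ p ∈ X, -(2 * R₀) ≤ p 2 ∧ p 2 ≤ h + 2 * R₀ ∧ p 0 ^ 2 + p 1 ^ 2 ≤ ρ ^ 2)
    (hP₁ : ∀ p, p ∈ P₁ ↔ (p ∈ (fun q => A₁ q + t₁) '' fccStacking 1 (Real.sqrt (2 / 3)) ∧
      -(2 * R₀) ≤ p 2 ∧ p 2 ≤ -R₀ ∧ p 0 ^ 2 + p 1 ^ 2 ≤ ρ ^ 2))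
    (hP₂ : ∀ p, p ∈ P₂ ↔ (p ∈ (fun q => A₂ q + t₂) '' fccStacking 1 (Real.sqrt (2 / 3)) ∧
      h + R₀ ≤ p 2 ∧ p 2 ≤ h + 2 * R₀ ∧ p 0 ^ 2 + p 1 ^ 2 ≤ ρ ^ 2)) :
    Φ * Real.pi * ρ ^ 2 - K * (1 + (h + 2 * (R₀ - 10))) * ρ ≤
      ∑ y ∈ X.filter (fun y => (X.filter fun q => dist y q = 1).card ≠ 12 ∧ -R₀ - 2 ≤ y 2 ∧ y 2 ≤ h + R₀ + 2),
        ((12 : ℝ) - ((X.filter fun q => dist y q = 1).card : ℝ)) := by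
  set e₃ : EuclideanSpace ℝ (Fin 3) := EuclideanSpace.single (2 : Fin 3) (1 : ℝ) with he₃
  set τ : ℝ := R₀ - 10 with hτ
  have hτ0 : 0 ≤ τ := by rw [hτ]; linarith
  set v : EuclideanSpace ℝ (Fin 3) := τ • e₃ with hv
  have hsh : ∀ p : EuclideanSpace ℝ (Fin 3), (p + v) 2 = p 2 + τ ∧ (p + v) 0 = p 0 ∧ (p + v) 1 = p 1 :=
    fun p => shift_apply p τ
  set h'' : ℝ := h + 2 * τ with hh''
  have hh''0 : 0 ≤ h'' := by rw [hh'']; positivity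
  -- the truncated, shifted cell
  set sh : EuclideanSpace ℝ (Fin 3) → EuclideanSpace ℝ (Fin 3) := fun p => p + v with hshdef
  have hshinj : Function.Injective sh := fun p q hpq => add_right_cancel hpq
  set Xw := X.filter fun p => -R₀ - 10 ≤ p 2 ∧ p 2 ≤ h + R₀ + 10 with hXw
  set X' := Xw.image sh with hX'
  set P₁' := (P₁.filter fun p => -R₀ - 10 ≤ p 2).image sh with hP₁'
  set P₂' := (P₂.filter fun p => p 2 ≤ h + R₀ + 10).image sh with hP₂'
  have hmemX' : ∀ p, p + v ∈ X' ↔ p ∈ X ∧ -R₀ - 10 ≤ p 2 ∧ p 2 ≤ h + R₀ + 10 := by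
    intro p
    rw [hX', Finset.mem_image]
    constructor
    · rintro ⟨q, hq, hqp⟩
      have : q = p := hshinj hqp
      subst this
      exact ⟨(Finset.mem_filter.1 hq).1, (Finset.mem_filter.1 hq).2⟩
    · rintro ⟨hp, hw⟩; exact ⟨p, Finset.mem_filter.2 ⟨hp, hw⟩, rfl⟩
  -- hypotheses of the thickness-10 cell
  have hX's : ∀ p ∈ X', ∀ q ∈ X', p ≠ q → 1 ≤ dist p q := by
    intro p hp q hq hpq
    obtain ⟨p₀, hp₀, rfl⟩ := Finset.mem_image.1 hp
    obtain ⟨q₀, hq₀, rfl⟩ := Finset.mem_image.1 hq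
    have : dist (sh p₀) (sh q₀) = dist p₀ q₀ := by simp only [hshdef]; exact dist_add_right _ _ _
    rw [this]
    exact hX p₀ (Finset.mem_filter.1 hp₀).1 q₀ (Finset.mem_filter.1 hq₀).1 fun e => hpq (by rw [e])
  have hP₁X' : P₁' ⊆ X' := by
    intro p hp
    obtain ⟨p₀, hp₀, rfl⟩ := Finset.mem_image.1 hp
    obtain ⟨hp₀P, hlo⟩ := Finset.mem_filter.1 hp₀
    have h3 := ((hP₁ p₀).1 hp₀P).2.2.1
    exact (hmemX' p₀).2 ⟨hP₁X hp₀P, hlo, by linarith⟩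
  have hP₂X' : P₂' ⊆ X' \ P₁' := by
    intro p hp
    obtain ⟨p₀, hp₀, rfl⟩ := Finset.mem_image.1 hp
    obtain ⟨hp₀P, hhi⟩ := Finset.mem_filter.1 hp₀
    have hp₀XP := hP₂X hp₀P
    rw [Finset.mem_sdiff] at hp₀XP ⊢
    have h3 := ((hP₂ p₀).1 hp₀P).2.1
    refine ⟨(hmemX' p₀).2 ⟨hp₀XP.1, by linarith, hhi⟩, fun hq => ?_⟩
    obtain ⟨q₀, hq₀, hq₀p⟩ := Finset.mem_image.1 hq
    have : q₀ = p₀ := hshinj hq₀p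
    subst this
    exact hp₀XP.2 (Finset.mem_filter.1 hq₀).1
  have hcell' : ∀ p ∈ X', -(2 * 10) ≤ p 2 ∧ p 2 ≤ h'' + 2 * 10 ∧ p 0 ^ 2 + p 1 ^ 2 ≤ ρ ^ 2 := by
    intro p hp
    obtain ⟨p₀, hp₀, rfl⟩ := Finset.mem_image.1 hp
    obtain ⟨hp₀X, hlo, hhi⟩ := Finset.mem_filter.1 hp₀
    obtain ⟨h2, h0, h1⟩ := hsh p₀
    simp only [hshdef]
    rw [h2, h0, h1]
    exact ⟨by rw [hτ]; linarith, by rw [hh'', hτ]; linarith, (hcell p₀ hp₀X).2.2⟩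
  have hP₁'iff : ∀ p, p ∈ P₁' ↔ (p ∈ (fun q => A₁ q + (t₁ + v)) '' fccStacking 1 (Real.sqrt (2 / 3)) ∧
      -(2 * 10) ≤ p 2 ∧ p 2 ≤ -10 ∧ p 0 ^ 2 + p 1 ^ 2 ≤ ρ ^ 2) := by
    intro p
    constructor
    · intro hp
      obtain ⟨p₀, hp₀, rfl⟩ := Finset.mem_image.1 hp
      obtain ⟨hp₀P, hlo⟩ := Finset.mem_filter.1 hp₀
      obtain ⟨hΛ, h1, h2, h3⟩ := (hP₁ p₀).1 hp₀P
      obtain ⟨e2, e0, e1⟩ := hsh p₀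
      simp only [hshdef]; rw [e2, e0, e1]
      exact ⟨(mem_affine_shift_iff A₁ t₁ v p₀).2 hΛ, by rw [hτ]; linarith, by rw [hτ]; linarith, h3⟩
    · rintro ⟨hΛ, h1, h2, h3⟩
      have hp : p = (p - v) + v := (sub_add_cancel p v).symm
      obtain ⟨e2, e0, e1⟩ := hsh (p - v)
      rw [← hp] at e2 e0 e1
      have hΛ₀ : p - v ∈ (fun q => A₁ q + t₁) '' fccStacking 1 (Real.sqrt (2 / 3)) :=
        (mem_affine_shift_iff A₁ t₁ v (p - v)).1 (by rw [← hp]; exact hΛ)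
      have hq2 : (p - v) 2 = p 2 - τ := by linarith
      have hq0 : (p - v) 0 = p 0 := by linarith
      have hq1 : (p - v) 1 = p 1 := by linarith
      have hmem : p - v ∈ P₁ := (hP₁ _).2 ⟨hΛ₀, by rw [hq2, hτ]; linarith, by rw [hq2, hτ]; linarith, by rw [hq0, hq1]; exact h3⟩
      rw [hp]
      exact Finset.mem_image.2 ⟨p - v, Finset.mem_filter.2 ⟨hmem, by rw [hq2, hτ]; linarith⟩, rfl⟩
  have hP₂'iff : ∀ p, p ∈ P₂' ↔ (p ∈ (fun q => A₂ q + (t₂ + v)) '' fccStacking 1 (Real.sqrt (2 / 3)) ∧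
      h'' + 10 ≤ p 2 ∧ p 2 ≤ h'' + 2 * 10 ∧ p 0 ^ 2 + p 1 ^ 2 ≤ ρ ^ 2) := by
    intro p
    constructor
    · intro hp
      obtain ⟨p₀, hp₀, rfl⟩ := Finset.mem_image.1 hp
      obtain ⟨hp₀P, hhi⟩ := Finset.mem_filter.1 hp₀
      obtain ⟨hΛ, h1, h2, h3⟩ := (hP₂ p₀).1 hp₀P
      obtain ⟨e2, e0, e1⟩ := hsh p₀
      simp only [hshdef]; rw [e2, e0, e1]
      exact ⟨(mem_affine_shift_iff A₂ t₂ v p₀).2 hΛ, by rw [hh'', hτ]; linarith, by rw [hh'', hτ]; linarith, h3⟩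
    · rintro ⟨hΛ, h1, h2, h3⟩
      have hp : p = (p - v) + v := (sub_add_cancel p v).symm
      obtain ⟨e2, e0, e1⟩ := hsh (p - v)
      rw [← hp] at e2 e0 e1
      have hΛ₀ : p - v ∈ (fun q => A₂ q + t₂) '' fccStacking 1 (Real.sqrt (2 / 3)) :=
        (mem_affine_shift_iff A₂ t₂ v (p - v)).1 (by rw [← hp]; exact hΛ)
      have hq2 : (p - v) 2 = p 2 - τ := by linarith
      have hq0 : (p - v) 0 = p 0 := by linarith
      have hq1 : (p - v) 1 = p 1 := by linarith
      have hmem : p - v ∈ P₂ :=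
        (hP₂ _).2 ⟨hΛ₀, by rw [hq2, hh'', hτ] at *; linarith, by rw [hq2, hτ]; rw [hh'', hτ] at h2; linarith,
          by rw [hq0, hq1]; exact h3⟩
      rw [hp]
      exact Finset.mem_image.2 ⟨p - v, Finset.mem_filter.2 ⟨hmem, by rw [hq2]; rw [hh'', hτ] at h2; linarith⟩, rfl⟩
  -- the thickness-10 pool
  have hpool := hpool10 v h'' hh''0 ρ (by linarith) X' P₁' P₂' hX's hP₁X' hP₂X' hcell' hP₁'iff hP₂'iff
  -- the payer windows correspond, with equal degrees
  set PAY := X.filter (fun y => (X.filter fun q => dist y q = 1).card ≠ 12 ∧ -R₀ - 2 ≤ y 2 ∧ y 2 ≤ h + R₀ + 2) with hPAY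
  set PAY' := X'.filter (fun y => (X'.filter fun q => dist y q = 1).card ≠ 12 ∧ -10 - 2 ≤ y 2 ∧ y 2 ≤ h'' + 10 + 2) with hPAY'
  -- degrees of window balls are preserved
  have hdeg : ∀ y ∈ X, -R₀ - 2 ≤ y 2 → y 2 ≤ h + R₀ + 2 →
      (X'.filter fun q => dist (sh y) q = 1).card = (X.filter fun q => dist y q = 1).card := by
    intro y hy hlo hhi
    have hset : (X'.filter fun q => dist (sh y) q = 1) = (X.filter fun q => dist y q = 1).image sh := by
      ext q
      constructor
      · intro hq'
        obtain ⟨hq, hd⟩ := Finset.mem_filter.1 hq'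
        obtain ⟨q₀, hq₀, rfl⟩ := Finset.mem_image.1 hq
        have hd' : dist y q₀ = 1 := by have := dist_add_right y q₀ v; simp only [hshdef] at hd; rw [this] at hd; exact hd
        exact Finset.mem_image.2 ⟨q₀, Finset.mem_filter.2 ⟨(Finset.mem_filter.1 hq₀).1, hd'⟩, rfl⟩
      · intro hq'
        obtain ⟨q₀, hq₀, rfl⟩ := Finset.mem_image.1 hq'
        obtain ⟨hq₀X, hd⟩ := Finset.mem_filter.1 hq₀
        have hq2 : |q₀ 2 - y 2| ≤ 1 := by have := abs_sub_apply_le_dist q₀ y 2; rw [dist_comm] at this; linarith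
        have hq2' := abs_le.1 hq2
        refine Finset.mem_filter.2 ⟨(hmemX' q₀).2 ⟨hq₀X, by linarith, by linarith⟩, ?_⟩
        simp only [hshdef]; rw [dist_add_right]; exact hd
    rw [hset, Finset.card_image_of_injective _ hshinj]
  have hPAY'sub : PAY' ⊆ PAY.image sh := by
    intro y' hy'
    obtain ⟨hy'X, hdeg', hlo, hhi⟩ := Finset.mem_filter.1 hy'
    obtain ⟨y, hyw, rfl⟩ := Finset.mem_image.1 hy'X
    obtain ⟨hyX, -, -⟩ := Finset.mem_filter.1 hyw
    obtain ⟨e2, -, -⟩ := hsh y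
    simp only [hshdef] at hlo hhi
    rw [e2] at hlo hhi
    have hlo' : -R₀ - 2 ≤ y 2 := by rw [hτ] at hlo; linarith
    have hhi' : y 2 ≤ h + R₀ + 2 := by rw [hh'', hτ] at hhi; linarith
    refine Finset.mem_image.2 ⟨y, Finset.mem_filter.2 ⟨hyX, ?_, hlo', hhi'⟩, rfl⟩
    rw [← hdeg y hyX hlo' hhi']; exact hdeg'
  have hsum : ∑ y ∈ PAY', ((12 : ℝ) - ((X'.filter fun q => dist y q = 1).card : ℝ)) ≤
      ∑ y ∈ PAY, ((12 : ℝ) - ((X.filter fun q => dist y q = 1).card : ℝ)) := by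
    have h1 : ∑ y ∈ PAY', ((12 : ℝ) - ((X'.filter fun q => dist y q = 1).card : ℝ)) ≤
        ∑ y ∈ PAY.image sh, ((12 : ℝ) - ((X'.filter fun q => dist y q = 1).card : ℝ)) :=
      Finset.sum_le_sum_of_subset_of_nonneg hPAY'sub fun y _ _ => by
        have : ((X'.filter fun q => dist y q = 1).card : ℝ) ≤ 12 := by exact_mod_cast card_filter_dist_eq_one_le_twelve X' hX's y
        linarith
    rw [Finset.sum_image fun a _ b _ hab => hshinj hab] at h1
    refine h1.trans (le_of_eq (Finset.sum_congr rfl fun y hy => ?_))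
    obtain ⟨hyX, -, hlo, hhi⟩ := Finset.mem_filter.1 hy
    rw [hdeg y hyX hlo hhi]
  have hK : K * (1 + h'') * ρ = K * (1 + (h + 2 * (R₀ - 10))) * ρ := by rw [hh'', hτ]
  rw [← hK]
  exact hpool.trans hsum

/-! ### The two uniform pools at every thickness -/

open scoped Classical in
/-- **Separated-frame payer pool at every thickness `R₀ ≥ 10`** (uniform numeric constant). -/
theorem payerPool_local_sep_thick
    {s₀ : EuclideanSpace ℝ (Fin 3)} (hs₀ : s₀ ∈ fccSlots)
    (hcert : ExactOnly 0 (fccSlots.filter fun w => 0 < ⟪w, s₀⟫_ℝ))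
    (hDS : ∀ F₁ F₂ : EuclideanSpace ℝ (Fin 3) ≃ₗᵢ[ℝ] EuclideanSpace ℝ (Fin 3), DoubleStarCoaxialAt F₁ F₂)
    (hCP : CapPairCoaxial)
    (A₁ A₂ : EuclideanSpace ℝ (Fin 3) ≃ₗᵢ[ℝ] EuclideanSpace ℝ (Fin 3))
    {u₁ : EuclideanSpace ℝ (Fin 3)} (hu₁ : u₁ ∈ fccSlots)
    (hsteep₁ : Real.sqrt 2 / 2 ≤ ⟪A₁ u₁, EuclideanSpace.single (2 : Fin 3) (1 : ℝ)⟫_ℝ)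
    {u₂ : EuclideanSpace ℝ (Fin 3)} (hu₂ : u₂ ∈ fccSlots)
    (hsteep₂ : ⟪A₂ u₂, EuclideanSpace.single (2 : Fin 3) (1 : ℝ)⟫_ℝ ≤ -(Real.sqrt 2 / 2))
    (M₁ M₂ : Set (EuclideanSpace ℝ (Fin 3) ≃ₗᵢ[ℝ] EuclideanSpace ℝ (Fin 3)))
    (hM₁ : ∀ stk : List WalkEntry, StackSound (EuclideanSpace.single (2 : Fin 3) (1 : ℝ)) stk →
      StackWF (EuclideanSpace.single (2 : Fin 3) (1 : ℝ)) stk → stk.getLast? = some ⟨A₁, u₁, 0⟩ →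
      ∀ e ∈ stk, e.frame ∈ M₁)
    (hM₂ : ∀ stk : List WalkEntry, StackSound (-EuclideanSpace.single (2 : Fin 3) (1 : ℝ)) stk →
      StackWF (-EuclideanSpace.single (2 : Fin 3) (1 : ℝ)) stk → stk.getLast? = some ⟨A₂, u₂, 0⟩ →
      ∀ e ∈ stk, e.frame ∈ M₂)
    (hsep : ∀ F₁ ∈ M₁, ∀ F₂ ∈ M₂, ¬ ∃ (L : EuclideanSpace ℝ (Fin 3) ≃ₗᵢ[ℝ] EuclideanSpace ℝ (Fin 3))
        (s₁ s₂ : EuclideanSpace ℝ (Fin 3)) (σ σ' : ℤ → ℤ), IsHaggSeq σ ∧ IsHaggSeq σ' ∧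
        F₁ '' fccStacking 1 (Real.sqrt (2 / 3)) ⊆ (fun p => L p + s₁) '' barlowStacking 1 (Real.sqrt (2 / 3)) σ ∧
        F₂ '' fccStacking 1 (Real.sqrt (2 / 3)) ⊆ (fun p => L p + s₂) '' barlowStacking 1 (Real.sqrt (2 / 3)) σ')
    {R₀ : ℝ} (hR₀ : 10 ≤ R₀) (t₁ t₂ : EuclideanSpace ℝ (Fin 3)) (h : ℝ) (hh : 0 ≤ h) (ρ : ℝ) (hρ : R₀ ≤ ρ)
    (X P₁ P₂ : Finset (EuclideanSpace ℝ (Fin 3)))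
    (hX : ∀ p ∈ X, ∀ q ∈ X, p ≠ q → 1 ≤ dist p q) (hP₁X : P₁ ⊆ X) (hP₂X : P₂ ⊆ X \ P₁)
    (hcell : ∀ p ∈ X, -(2 * R₀) ≤ p 2 ∧ p 2 ≤ h + 2 * R₀ ∧ p 0 ^ 2 + p 1 ^ 2 ≤ ρ ^ 2)
    (hP₁ : ∀ p, p ∈ P₁ ↔ (p ∈ (fun q => A₁ q + t₁) '' fccStacking 1 (Real.sqrt (2 / 3)) ∧
      -(2 * R₀) ≤ p 2 ∧ p 2 ≤ -R₀ ∧ p 0 ^ 2 + p 1 ^ 2 ≤ ρ ^ 2))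
    (hP₂ : ∀ p, p ∈ P₂ ↔ (p ∈ (fun q => A₂ q + t₂) '' fccStacking 1 (Real.sqrt (2 / 3)) ∧
      h + R₀ ≤ p 2 ∧ p 2 ≤ h + 2 * R₀ ∧ p 0 ^ 2 + p 1 ^ 2 ≤ ρ ^ 2)) :
    (Real.sqrt 2 * |⟪A₁ u₁, EuclideanSpace.single (2 : Fin 3) (1 : ℝ)⟫_ℝ| +
        Real.sqrt 2 * |⟪A₂ u₂, EuclideanSpace.single (2 : Fin 3) (1 : ℝ)⟫_ℝ|) * Real.pi * ρ ^ 2 -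
      2 * 2000 * (1 + (h + 2 * (R₀ - 10))) * ρ ≤
      ∑ y ∈ X.filter (fun y => (X.filter fun q => dist y q = 1).card ≠ 12 ∧ -R₀ - 2 ≤ y 2 ∧ y 2 ≤ h + R₀ + 2),
        ((12 : ℝ) - ((X.filter fun q => dist y q = 1).card : ℝ)) :=
  payerPool_reanchor A₁ A₂ t₁ t₂ (K := 2 * 2000)
    (fun w h hh ρ hρ X P₁ P₂ hX hP₁X hP₂X hcell hP₁ hP₂ =>
      payerPool_local_sep hs₀ hcert hDS hCP A₁ (t₁ + w) A₂ (t₂ + w) hu₁ hsteep₁ hu₂ hsteep₂ M₁ M₂ hM₁ hM₂ hsep h hh ρ hρ X P₁ P₂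
        hX hP₁X hP₂X hcell hP₁ hP₂)
    hR₀ h hh ρ hρ X P₁ P₂ hX hP₁X hP₂X hcell hP₁ hP₂

open scoped Classical in
/-- **Off-reach payer pool at every thickness `R₀ ≥ 10`** (uniform numeric constant; the reach sets shift with the translation). -/
theorem payerPool_offReach_thick
    {s₀ : EuclideanSpace ℝ (Fin 3)} (hs₀ : s₀ ∈ fccSlots)
    (hcert : ExactOnly 0 (fccSlots.filter fun w => 0 < ⟪w, s₀⟫_ℝ))
    (hDS : ∀ F₁ F₂ : EuclideanSpace ℝ (Fin 3) ≃ₗᵢ[ℝ] EuclideanSpace ℝ (Fin 3), DoubleStarCoaxialAt F₁ F₂)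
    (hCP : CapPairCoaxial)
    (A₁ : EuclideanSpace ℝ (Fin 3) ≃ₗᵢ[ℝ] EuclideanSpace ℝ (Fin 3)) (t₁ : EuclideanSpace ℝ (Fin 3))
    (A₂ : EuclideanSpace ℝ (Fin 3) ≃ₗᵢ[ℝ] EuclideanSpace ℝ (Fin 3)) (t₂ : EuclideanSpace ℝ (Fin 3))
    {u₁ : EuclideanSpace ℝ (Fin 3)} (hu₁ : u₁ ∈ fccSlots)
    (hsteep₁ : Real.sqrt 2 / 2 ≤ ⟪A₁ u₁, EuclideanSpace.single (2 : Fin 3) (1 : ℝ)⟫_ℝ)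
    {u₂ : EuclideanSpace ℝ (Fin 3)} (hu₂ : u₂ ∈ fccSlots)
    (hsteep₂ : ⟪A₂ u₂, EuclideanSpace.single (2 : Fin 3) (1 : ℝ)⟫_ℝ ≤ -(Real.sqrt 2 / 2))
    (M₁ M₂ : Set (EuclideanSpace ℝ (Fin 3) ≃ₗᵢ[ℝ] EuclideanSpace ℝ (Fin 3)))
    (hM₁ : ∀ stk : List WalkEntry, StackSound (EuclideanSpace.single (2 : Fin 3) (1 : ℝ)) stk →
      StackWF (EuclideanSpace.single (2 : Fin 3) (1 : ℝ)) stk → stk.getLast? = some ⟨A₁, u₁, 0⟩ →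
      ∀ e ∈ stk, e.frame ∈ M₁)
    (hM₂ : ∀ stk : List WalkEntry, StackSound (-EuclideanSpace.single (2 : Fin 3) (1 : ℝ)) stk →
      StackWF (-EuclideanSpace.single (2 : Fin 3) (1 : ℝ)) stk → stk.getLast? = some ⟨A₂, u₂, 0⟩ →
      ∀ e ∈ stk, e.frame ∈ M₂)
    (hoff : ∀ y ∈ reachSet A₁ t₁ M₁, y ∉ reachSet A₂ t₂ M₂)
    {R₀ : ℝ} (hR₀ : 10 ≤ R₀) (h : ℝ) (hh : 0 ≤ h) (ρ : ℝ) (hρ : R₀ ≤ ρ)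
    (X P₁ P₂ : Finset (EuclideanSpace ℝ (Fin 3)))
    (hX : ∀ p ∈ X, ∀ q ∈ X, p ≠ q → 1 ≤ dist p q) (hP₁X : P₁ ⊆ X) (hP₂X : P₂ ⊆ X \ P₁)
    (hcell : ∀ p ∈ X, -(2 * R₀) ≤ p 2 ∧ p 2 ≤ h + 2 * R₀ ∧ p 0 ^ 2 + p 1 ^ 2 ≤ ρ ^ 2)
    (hP₁ : ∀ p, p ∈ P₁ ↔ (p ∈ (fun q => A₁ q + t₁) '' fccStacking 1 (Real.sqrt (2 / 3)) ∧
      -(2 * R₀) ≤ p 2 ∧ p 2 ≤ -R₀ ∧ p 0 ^ 2 + p 1 ^ 2 ≤ ρ ^ 2))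
    (hP₂ : ∀ p, p ∈ P₂ ↔ (p ∈ (fun q => A₂ q + t₂) '' fccStacking 1 (Real.sqrt (2 / 3)) ∧
      h + R₀ ≤ p 2 ∧ p 2 ≤ h + 2 * R₀ ∧ p 0 ^ 2 + p 1 ^ 2 ≤ ρ ^ 2)) :
    (Real.sqrt 2 * |⟪A₁ u₁, EuclideanSpace.single (2 : Fin 3) (1 : ℝ)⟫_ℝ| +
        Real.sqrt 2 * |⟪A₂ u₂, EuclideanSpace.single (2 : Fin 3) (1 : ℝ)⟫_ℝ|) * Real.pi * ρ ^ 2 -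
      2 * 2000 * (1 + (h + 2 * (R₀ - 10))) * ρ ≤
      ∑ y ∈ X.filter (fun y => (X.filter fun q => dist y q = 1).card ≠ 12 ∧ -R₀ - 2 ≤ y 2 ∧ y 2 ≤ h + R₀ + 2),
        ((12 : ℝ) - ((X.filter fun q => dist y q = 1).card : ℝ)) := by
  refine payerPool_reanchor A₁ A₂ t₁ t₂ (K := 2 * 2000) (fun w h hh ρ hρ X P₁ P₂ hX hP₁X hP₂X hcell hP₁ hP₂ => ?_)
    hR₀ h hh ρ hρ X P₁ P₂ hX hP₁X hP₂X hcell hP₁ hP₂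
  -- the reach sets translate along the common shift, so they stay disjoint
  have hoff' : ∀ y ∈ reachSet A₁ (t₁ + w) M₁, y ∉ reachSet A₂ (t₂ + w) M₂ := by
    intro y hy hy'
    have h1 : y - w ∈ reachSet A₁ t₁ M₁ := (reachSet_shift A₁ t₁ w M₁ (y - w)).2 (by rw [sub_add_cancel]; exact hy)
    have h2 : y - w ∈ reachSet A₂ t₂ M₂ := (reachSet_shift A₂ t₂ w M₂ (y - w)).2 (by rw [sub_add_cancel]; exact hy')
    exact hoff _ h1 h2
  exact payerPool_offReach hs₀ hcert hDS hCP A₁ (t₁ + w) A₂ (t₂ + w) hu₁ hsteep₁ hu₂ hsteep₂ M₁ M₂ hM₁ hM₂ hoff' h hh ρ hρ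
    X P₁ P₂ hX hP₁X hP₂X hcell hP₁ hP₂

end Summit.Ventures.Crystal3D.Theorems

end
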